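import Summits.HodgeConjecture.CorCM.GaloisRankTableCertificates
import HarnessLib

/-!
# Table models from generators and relations, I: recognition helpers; the metacyclic laws on `ZMod 8 × ZMod 2`
# (`D₁₆`, `Q₁₆`, `SD₁₆`, `M₁₆`) and on `ZMod 4 × ZMod 4` (`C₄ ⋊ C₄`)

COR-CM (cell `pub-hodgecm2`), binder seat b04 (gen 17), count-neutral claim GALOIS16-COMPLETE.  KERNEL ONLY:
theorems; no definition, no named fact, no `sorry`.  `HC_CM` is neither used nor claimed.  Pure group theory.

A TABLE MODEL of a finite group `G` (`GaloisRankTableCertificates`) is a bijection `e : G ≃ X` onto a finite type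
with an operation `mul` such that `e (g h) = mul (e g) (e h)`.  Here such `e` are PRODUCED from generators of `G`
satisfying relations, by the word maps `(i, j) ↦ rⁱ sʲ`:

* §1 `exists_table_equiv_of_words` — a word map `f : X → G`, multiplicative for `mul`, with trivial kernel, on a
  table with right quasi-inverses and cancellation (decidable data), is a bijection as soon as `|G| = |X|`;
  `exists_mulEquiv_of_table` — a decidable multiplicative bijection `X → G₀` onto a concrete group upgrades a
  table model to `G ≃* G₀` (feeding gen 16's censuses over `DihedralGroup 8`, `QuaternionGroup 4`, …).
* §2 law A on `ZMod 8 × ZMod 2`, `(i,j)·(i',j') = (i + μʲ i' + τ j j', j + j')`: **`exists_table_lawA`** — `r` of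
  order `8`, `s ∉ ⟨r⟩`, `s r = r^μ s`, `s² = r^τ`, `|G| = 16` ⟹ a table model with `e r = (1,0)`, `e s = (0,1)`;
  instances `exists_table_d16` (`μ = 7, τ = 0`), `exists_table_q16` (`7, 4`), `exists_table_sd16` (`3, 0`),
  `exists_table_m16` (`5, 0`) for the laws written in `GaloisSixteenDegenerateTablesA` / the bridges.
* §3 law B on `ZMod 4 × ZMod 4`, `(i,j)·(i',j') = (i + 3^{[j odd]} i', j + j')`: **`exists_table_c4c4`** — `x` of
  order `4`, `y x = x³ y`, `y⁴ = 1`, `yʲ ∉ ⟨x⟩` (`0 < j < 4`), `|G| = 16`.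

## References

* [Shimura1998] G. Shimura, *Abelian Varieties with Complex Multiplication and Modular Functions*, §8.1 (the
  Galois group indexing the embeddings; the models are read there).
* [Dodson1984] B. Dodson, *The structure of Galois groups of CM-fields*, Trans. AMS 283 (1984), §5.3.1.
-/

namespace Summit.HodgeConjecture.CorCM.GaloisTableLaws

/-! ## §1 Recognition helpers -/

section Recognition

variable {X : Type*} [Fintype X] [DecidableEq X]
variable {G : Type*} [Group G] [Finite G]

omit [DecidableEq X] in
/-- **Recognition of a table from words.**  Let `f : X → G` be multiplicative for `mul` (`f (mul p q) = f p · f q`),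
with trivial kernel (`f p = 1 → p = o`), on a table with right quasi-inverses (`∀ q ∃ q', mul q q' = o`) and right
cancellation towards `o` (`mul q q' = o = mul p q' → p = q`; both decidable), and `|G| = |X|`.  Then `f` is a
bijection: `e = f⁻¹ : G ≃ X` is a table model with `e (f p) = p`. [folklore] -/
theorem exists_table_equiv_of_words (mul : X → X → X) (o : X) (f : X → G)
    (hf : ∀ p q : X, f (mul p q) = f p * f q) (hker : ∀ p : X, f p = 1 → p = o)
    (hinv : ∀ q : X, ∃ q' : X, mul q q' = o) (hcancel : ∀ p q q' : X, mul q q' = o → mul p q' = o → p = q)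
    (hcard : Nat.card G = Fintype.card X) :
    ∃ e : G ≃ X, (∀ a b : G, e (a * b) = mul (e a) (e b)) ∧ ∀ p : X, e (f p) = p := by
  have ho1 : f o = 1 := by
    obtain ⟨o', ho'⟩ := hinv o
    have h1 : f o * f o' = f o := by rw [← hf, ho']
    have h2 : f o' = 1 := mul_left_cancel (a := f o) (by rw [h1, mul_one])
    have h3 : o' = o := hker o' h2
    rw [h3] at ho'
    have h4 : f o * f o = f o := by rw [← hf, ho']
    exact mul_left_cancel (a := f o) (by rw [h4, mul_one])
  have hinj : Function.Injective f := by
    intro p q hpq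
    obtain ⟨q', hq'⟩ := hinv q
    have h1 : f (mul p q') = 1 := by rw [hf, hpq, ← hf, hq', ho1]
    exact hcancel p q q' hq' (hker _ h1)
  have hbij : Function.Bijective f :=
    hinj.bijective_of_nat_card_le (by rw [hcard, Nat.card_eq_fintype_card])
  refine ⟨(Equiv.ofBijective f hbij).symm, fun a b => ?_, fun p => ?_⟩
  · obtain ⟨p, rfl⟩ := hbij.2 a
    obtain ⟨q, rfl⟩ := hbij.2 b
    rw [← hf]
    simp only [Equiv.ofBijective_symm_apply_apply]
  · simp only [Equiv.ofBijective_symm_apply_apply]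

omit [Fintype X] [DecidableEq X] [Finite G] in
/-- **A table isomorphic to a concrete group by a multiplicative bijection gives `G ≃* G₀`.** [folklore] -/
theorem exists_mulEquiv_of_table {G₀ : Type*} [Group G₀] (mul : X → X → X) (e : G ≃ X)
    (hmul : ∀ a b : G, e (a * b) = mul (e a) (e b)) (ε : X → G₀) (hε : ∀ p q : X, ε (mul p q) = ε p * ε q)
    (hbij : Function.Bijective ε) : ∃ e' : G ≃* G₀, ∀ g : G, e' g = ε (e g) :=
  ⟨MulEquiv.mk' (e.trans (Equiv.ofBijective ε hbij)) fun a b => by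
    simp only [Equiv.trans_apply, Equiv.ofBijective_apply, hmul, hε], fun _ => rfl⟩

end Recognition

/-! ## §2 Law A: `ZMod 8 × ZMod 2`, `(i,j) ↦ rⁱ sʲ` -/

section LawA

variable {G : Type*} [Group G]

/-- `s rⁿ = r^{μ n} s` from `s r = r^μ s`. [folklore] -/
theorem s_mul_pow (r s : G) (μ : ℕ) (hsr : s * r = r ^ μ * s) (n : ℕ) : s * r ^ n = r ^ (μ * n) * s := by
  induction n with
  | zero => simp
  | succ n ih => rw [pow_succ, ← mul_assoc, ih, mul_assoc, hsr, ← mul_assoc, ← pow_add, Nat.mul_succ]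

/-- `r^a = r^b` when `a ≡ b (mod n)` and `rⁿ = 1`. [folklore] -/
theorem pow_eq_pow_of_mod_eq (r : G) {n : ℕ} (hr : r ^ n = 1) {a b : ℕ} (h : a % n = b % n) :
    r ^ a = r ^ b := by
  rw [← Nat.div_add_mod a n, ← Nat.div_add_mod b n, pow_add, pow_add, pow_mul, pow_mul, hr, one_pow, one_pow, h]

/-- NORMAL FORM for law A: `(rⁱ sʲ)(r^{i'} s^{j'})`, `j, j' ∈ {0, 1}`. [folklore] -/
theorem lawA_nf (r s : G) (μ τ : ℕ) (hsr : s * r = r ^ μ * s) (hss : s * s = r ^ τ) (i i' : ℕ) :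
    (r ^ i * s ^ 0) * (r ^ i' * s ^ 0) = r ^ (i + i') * s ^ 0 ∧
    (r ^ i * s ^ 0) * (r ^ i' * s ^ 1) = r ^ (i + i') * s ^ 1 ∧
    (r ^ i * s ^ 1) * (r ^ i' * s ^ 0) = r ^ (i + μ * i') * s ^ 1 ∧
    (r ^ i * s ^ 1) * (r ^ i' * s ^ 1) = r ^ (i + μ * i' + τ) * s ^ 0 := by
  refine ⟨?_, ?_, ?_, ?_⟩
  · simp only [pow_zero, mul_one, pow_add]
  · simp only [pow_zero, mul_one, pow_one, pow_add, mul_assoc]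
  · rw [pow_zero, pow_one, mul_one, mul_assoc, s_mul_pow r s μ hsr, ← mul_assoc, ← pow_add]
  · rw [pow_one, pow_zero, mul_one, mul_assoc, ← mul_assoc s, s_mul_pow r s μ hsr, mul_assoc, hss, ← mul_assoc,
      ← pow_add, ← pow_add]

/-- Every element of `ZMod 2` is `0` or `1`. [folklore] -/
theorem zmod2_cases : ∀ j : ZMod 2, j = 0 ∨ j = 1 := by decide

/-- **Table model for law A.**  `r` of order `8`, `s ∉ ⟨r⟩`, `s r = r^μ s`, `s² = r^τ` (`μ, τ` read in `ZMod 8`),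
`|G| = 16`, and an operation `mul` on `ZMod 8 × ZMod 2` agreeing with `(i,j)·(i',j') = (i + μʲ i' + τ j j', j + j')`
and having right quasi-inverses and cancellation (decidable data, supplied by `decide` at each instance): the word
map `(i,j) ↦ rⁱ sʲ` inverts to a table model `e` with `e r = (1,0)`, `e s = (0,1)`, `e 1 = (0,0)`. [folklore] -/
theorem exists_table_lawA [Finite G] (r s : G) (μ τ : ZMod 8) (hr : orderOf r = 8)
    (hs : s ∉ Subgroup.zpowers r) (hsr : s * r = r ^ μ.val * s) (hss : s * s = r ^ τ.val)
    (hcard : Nat.card G = 16) (mul : ZMod 8 × ZMod 2 → ZMod 8 × ZMod 2 → ZMod 8 × ZMod 2)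
    (h00 : ∀ i i' : ZMod 8, mul (i, 0) (i', 0) = (i + i', 0))
    (h01 : ∀ i i' : ZMod 8, mul (i, 0) (i', 1) = (i + i', 1))
    (h10 : ∀ i i' : ZMod 8, mul (i, 1) (i', 0) = (i + μ * i', 1))
    (h11 : ∀ i i' : ZMod 8, mul (i, 1) (i', 1) = (i + μ * i' + τ, 0))
    (hinv : ∀ q : ZMod 8 × ZMod 2, ∃ q', mul q q' = (0, 0))
    (hcancel : ∀ p q q' : ZMod 8 × ZMod 2, mul q q' = (0, 0) → mul p q' = (0, 0) → p = q) :
    ∃ e : G ≃ ZMod 8 × ZMod 2, (∀ a b : G, e (a * b) = mul (e a) (e b)) ∧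
      e r = (1, 0) ∧ e s = (0, 1) ∧ e 1 = (0, 0) := by
  have hr8 : r ^ 8 = 1 := by rw [← hr]; exact pow_orderOf_eq_one r
  -- the word map
  set f : ZMod 8 × ZMod 2 → G := fun p => r ^ p.1.val * s ^ p.2.val with hf_def
  have hv0 : (0 : ZMod 2).val = 0 := rfl
  have hv1 : (1 : ZMod 2).val = 1 := rfl
  have hfval : ∀ (E : ZMod 8) (c : ZMod 2) (N : ℕ), E.val % 8 = N % 8 → f (E, c) = r ^ N * s ^ c.val := by
    intro E c N hN
    simp only [hf_def]
    rw [pow_eq_pow_of_mod_eq r hr8 hN]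
  have hvμ : ∀ i' : ZMod 8, (μ * i').val % 8 = μ.val * i'.val % 8 := fun i' => by
    rw [ZMod.val_mul]; exact Nat.mod_mod _ _
  have hf : ∀ p q, f (mul p q) = f p * f q := by
    rintro ⟨i, j⟩ ⟨i', j'⟩
    obtain ⟨n00, n01, n10, n11⟩ := lawA_nf r s μ.val τ.val hsr hss i.val i'.val
    rcases zmod2_cases j with rfl | rfl <;> rcases zmod2_cases j' with rfl | rfl
    · rw [h00, hfval (i + i') 0 (i.val + i'.val) (by rw [ZMod.val_add]; omega)]
      simp only [hf_def, hv0]; exact n00.symm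
    · rw [h01, hfval (i + i') 1 (i.val + i'.val) (by rw [ZMod.val_add]; omega)]
      simp only [hf_def, hv0, hv1]; exact n01.symm
    · rw [h10, hfval (i + μ * i') 1 (i.val + μ.val * i'.val) (by
        have := hvμ i'; rw [ZMod.val_add]; generalize μ.val * i'.val = M at this ⊢; omega)]
      simp only [hf_def, hv0, hv1]; exact n10.symm
    · rw [h11, hfval (i + μ * i' + τ) 0 (i.val + μ.val * i'.val + τ.val) (by
        have := hvμ i'; rw [ZMod.val_add, ZMod.val_add]; generalize μ.val * i'.val = M at this ⊢; omega)]
      simp only [hf_def, hv0, hv1]; exact n11.symm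
  have hker : ∀ p, f p = 1 → p = (0, 0) := by
    rintro ⟨i, j⟩ h
    simp only [hf_def] at h
    rcases zmod2_cases j with rfl | rfl
    · rw [hv0, pow_zero, mul_one] at h
      have hdvd : orderOf r ∣ i.val := orderOf_dvd_of_pow_eq_one h
      rw [hr] at hdvd
      have hi : i.val = 0 := by have := ZMod.val_lt i; omega
      rw [ZMod.val_eq_zero] at hi
      rw [hi]
    · exfalso
      rw [hv1, pow_one, mul_eq_one_iff_eq_inv] at h
      have h' : s = (r ^ i.val)⁻¹ := by rw [← inv_inj, ← h, inv_inv]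
      exact hs (h' ▸ Subgroup.inv_mem _ (Subgroup.pow_mem _ (Subgroup.mem_zpowers r) _))
  obtain ⟨e, he, hef⟩ := exists_table_equiv_of_words mul (0, 0) f hf hker hinv hcancel
    (by rw [hcard]; simp [ZMod.card])
  refine ⟨e, he, ?_, ?_, ?_⟩
  · have h := hef (1, 0)
    simp only [hf_def, hv0, pow_zero, mul_one] at h
    rwa [show (1 : ZMod 8).val = 1 from rfl, pow_one] at h
  · have h := hef (0, 1)
    simp only [hf_def, hv1, pow_one, ZMod.val_zero, pow_zero, one_mul] at h
    exact h
  · have h := hef (0, 0)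
    simp only [hf_def, hv0, ZMod.val_zero, pow_zero, mul_one] at h
    exact h

/-- **`D₁₆`-type generators** (`s r = r⁷ s = r⁻¹ s`, `s² = 1`): a table model for the law
`(i,j)·(i',j') = (i + 7ʲ i', j + j')`. [folklore] -/
theorem exists_table_d16 [Finite G] (r s : G) (hr : orderOf r = 8) (hs : s ∉ Subgroup.zpowers r)
    (hsr : s * r = r ^ 7 * s) (hss : s * s = 1) (hcard : Nat.card G = 16) :
    ∃ e : G ≃ ZMod 8 × ZMod 2, (∀ a b : G, e (a * b) =
      (fun p q : ZMod 8 × ZMod 2 => (p.1 + (if p.2 = 0 then q.1 else 7 * q.1), p.2 + q.2)) (e a) (e b)) ∧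
      e r = (1, 0) ∧ e s = (0, 1) ∧ e 1 = (0, 0) :=
  exists_table_lawA r s 7 0 hr hs hsr (by simpa using hss) hcard
    (fun p q : ZMod 8 × ZMod 2 => (p.1 + (if p.2 = 0 then q.1 else 7 * q.1), p.2 + q.2))
    (by decide) (by decide) (by decide) (by decide) (by decide) (by decide)

/-- **`Q₁₆`-type generators** (`s r = r⁷ s`, `s² = r⁴`): a table model for the law
`(i,j)·(i',j') = (i + 7ʲ i' + 4 j j', j + j')`. [folklore] -/
theorem exists_table_q16 [Finite G] (r s : G) (hr : orderOf r = 8) (hs : s ∉ Subgroup.zpowers r)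
    (hsr : s * r = r ^ 7 * s) (hss : s * s = r ^ 4) (hcard : Nat.card G = 16) :
    ∃ e : G ≃ ZMod 8 × ZMod 2, (∀ a b : G, e (a * b) =
      (fun p q : ZMod 8 × ZMod 2 => (p.1 + (if p.2 = 0 then q.1 else 7 * q.1 + (if q.2 = 0 then 0 else 4)),
        p.2 + q.2)) (e a) (e b)) ∧
      e r = (1, 0) ∧ e s = (0, 1) ∧ e 1 = (0, 0) :=
  exists_table_lawA r s 7 4 hr hs hsr hss hcard
    (fun p q : ZMod 8 × ZMod 2 => (p.1 + (if p.2 = 0 then q.1 else 7 * q.1 + (if q.2 = 0 then 0 else 4)),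
        p.2 + q.2))
    (by decide) (by decide) (by decide) (by decide) (by decide) (by decide)

/-- **`SD₁₆`-type generators** (`s r = r³ s`, `s² = 1`): a table model for the law of
`GaloisSixteenDegenerateTablesA` (`exists_simple_degenerate_sd16`). [folklore] -/
theorem exists_table_sd16 [Finite G] (r s : G) (hr : orderOf r = 8) (hs : s ∉ Subgroup.zpowers r)
    (hsr : s * r = r ^ 3 * s) (hss : s * s = 1) (hcard : Nat.card G = 16) :
    ∃ e : G ≃ ZMod 8 × ZMod 2, (∀ a b : G, e (a * b) =
      (fun p q : ZMod 8 × ZMod 2 => (p.1 + (if p.2 = 0 then q.1 else 3 * q.1), p.2 + q.2)) (e a) (e b)) ∧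
      e r = (1, 0) ∧ e s = (0, 1) ∧ e 1 = (0, 0) :=
  exists_table_lawA r s 3 0 hr hs hsr (by simpa using hss) hcard
    (fun p q : ZMod 8 × ZMod 2 => (p.1 + (if p.2 = 0 then q.1 else 3 * q.1), p.2 + q.2))
    (by decide) (by decide) (by decide) (by decide) (by decide) (by decide)

/-- **`M₁₆`-type generators** (`s r = r⁵ s`, `s² = 1`): a table model for the law of
`GaloisSixteenDegenerateTablesA` (`exists_simple_degenerate_m16`). [folklore] -/
theorem exists_table_m16 [Finite G] (r s : G) (hr : orderOf r = 8) (hs : s ∉ Subgroup.zpowers r)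
    (hsr : s * r = r ^ 5 * s) (hss : s * s = 1) (hcard : Nat.card G = 16) :
    ∃ e : G ≃ ZMod 8 × ZMod 2, (∀ a b : G, e (a * b) =
      (fun p q : ZMod 8 × ZMod 2 => (p.1 + (if p.2 = 0 then q.1 else 5 * q.1), p.2 + q.2)) (e a) (e b)) ∧
      e r = (1, 0) ∧ e s = (0, 1) ∧ e 1 = (0, 0) :=
  exists_table_lawA r s 5 0 hr hs hsr (by simpa using hss) hcard
    (fun p q : ZMod 8 × ZMod 2 => (p.1 + (if p.2 = 0 then q.1 else 5 * q.1), p.2 + q.2))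
    (by decide) (by decide) (by decide) (by decide) (by decide) (by decide)

end LawA

/-! ## §3 Law B: `ZMod 4 × ZMod 4`, `(i,j) ↦ xⁱ yʲ` with `y x = x³ y` (the group `C₄ ⋊ C₄`) -/

section LawB

variable {G : Type*} [Group G]

/-- `yⁿ xᵐ = x^{3ⁿ m} yⁿ` from `y x = x³ y`. [folklore] -/
theorem pow_mul_pow_of_yx (x y : G) (hyx : y * x = x ^ 3 * y) (n m : ℕ) :
    y ^ n * x ^ m = x ^ (3 ^ n * m) * y ^ n := by
  induction n generalizing m with
  | zero => simp
  | succ n ih =>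
    have h3 : 3 ^ n * (3 * m) = 3 ^ (n + 1) * m := by ring
    rw [pow_succ, mul_assoc, s_mul_pow x y 3 hyx m, ← mul_assoc, ih, mul_assoc, ← pow_succ, h3]

/-- Every element of `ZMod 4` is `0, 1, 2` or `3`. [folklore] -/
theorem zmod4_cases : ∀ j : ZMod 4, j = 0 ∨ j = 1 ∨ j = 2 ∨ j = 3 := by decide

/-- **Table model for law B** (`C₄ ⋊ C₄`).  `x` of order `4`, `y x = x³ y`, `y⁴ = 1`, `yʲ ∉ ⟨x⟩` for `0 < j < 4`,
`|G| = 16`: the word map `(i,j) ↦ xⁱ yʲ` inverts to a table model for the law of `GaloisSixteenDegenerateTablesA`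
(`exists_simple_degenerate_c4c4x/y/xy`), with `e x = (1,0)`, `e y = (0,1)`, `e 1 = (0,0)`. [folklore] -/
theorem exists_table_c4c4 [Finite G] (x y : G) (hx : orderOf x = 4) (hyx : y * x = x ^ 3 * y) (hy4 : y ^ 4 = 1)
    (hy : ∀ j : ℕ, 0 < j → j < 4 → y ^ j ∉ Subgroup.zpowers x) (hcard : Nat.card G = 16) :
    ∃ e : G ≃ ZMod 4 × ZMod 4, (∀ a b : G, e (a * b) =
      (fun p q : ZMod 4 × ZMod 4 => (p.1 + (if 2 * p.2 = 0 then q.1 else 3 * q.1), p.2 + q.2)) (e a) (e b)) ∧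
      e x = (1, 0) ∧ e y = (0, 1) ∧ e 1 = (0, 0) := by
  have hx4 : x ^ 4 = 1 := by rw [← hx]; exact pow_orderOf_eq_one x
  set mul : ZMod 4 × ZMod 4 → ZMod 4 × ZMod 4 → ZMod 4 × ZMod 4 :=
    fun p q => (p.1 + (if 2 * p.2 = 0 then q.1 else 3 * q.1), p.2 + q.2) with hmul_def
  set f : ZMod 4 × ZMod 4 → G := fun p => x ^ p.1.val * y ^ p.2.val with hf_def
  -- `y^{j} x^{m} = x^{c m} y^{j}` with `c = 1` or `3` according to the parity of `j`
  have hconj : ∀ (j : ZMod 4) (m : ℕ), ∃ c : ℕ, y ^ j.val * x ^ m = x ^ (c * m) * y ^ j.val ∧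
      ∀ i i' : ZMod 4, (i + (if 2 * j = 0 then i' else 3 * i')).val % 4 = (i.val + c * i'.val) % 4 := by
    intro j m
    refine ⟨3 ^ j.val, pow_mul_pow_of_yx x y hyx j.val m, fun i i' => ?_⟩
    rcases zmod4_cases j with rfl | rfl | rfl | rfl
    · rw [if_pos (by decide : (2 : ZMod 4) * 0 = 0), ZMod.val_add, ZMod.val_zero, pow_zero]; omega
    · rw [if_neg (by decide : ¬ (2 : ZMod 4) * 1 = 0), ZMod.val_add, ZMod.val_mul, show (1 : ZMod 4).val = 1 from rfl,
        show (3 : ZMod 4).val = 3 from rfl, pow_one]; omega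
    · rw [if_pos (by decide : (2 : ZMod 4) * 2 = 0), ZMod.val_add, show (2 : ZMod 4).val = 2 from rfl]
      norm_num; omega
    · rw [if_neg (by decide : ¬ (2 : ZMod 4) * 3 = 0), ZMod.val_add, ZMod.val_mul,
        show (3 : ZMod 4).val = 3 from rfl]
      norm_num; omega
  have hf : ∀ p q, f (mul p q) = f p * f q := by
    rintro ⟨i, j⟩ ⟨i', j'⟩
    obtain ⟨c, hc, hval⟩ := hconj j i'.val
    simp only [hf_def, hmul_def]
    rw [mul_assoc, ← mul_assoc (y ^ j.val), hc, mul_assoc, ← pow_add, ← mul_assoc, ← pow_add]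
    rw [pow_eq_pow_of_mod_eq x hx4 (hval i i'), pow_eq_pow_of_mod_eq y hy4 (a := (j + j').val)
      (b := j.val + j'.val) (by rw [ZMod.val_add]; omega)]
  have hker : ∀ p, f p = 1 → p = (0, 0) := by
    rintro ⟨i, j⟩ h
    simp only [hf_def] at h
    by_cases hj : j = 0
    · subst hj
      rw [ZMod.val_zero, pow_zero, mul_one] at h
      have hdvd : orderOf x ∣ i.val := orderOf_dvd_of_pow_eq_one h
      rw [hx] at hdvd
      have hi : i.val = 0 := by have := ZMod.val_lt i; omega
      rw [ZMod.val_eq_zero] at hi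
      rw [hi]
    · exfalso
      have hjpos : 0 < j.val := by
        rcases Nat.eq_zero_or_pos j.val with h0 | h0
        · exact absurd ((ZMod.val_eq_zero j).1 h0) hj
        · exact h0
      refine hy j.val hjpos (ZMod.val_lt j) ?_
      rw [mul_eq_one_iff_eq_inv] at h
      have h' : y ^ j.val = (x ^ i.val)⁻¹ := by rw [← inv_inj, ← h, inv_inv]
      exact h' ▸ Subgroup.inv_mem _ (Subgroup.pow_mem _ (Subgroup.mem_zpowers x) _)
  obtain ⟨e, he, hef⟩ := exists_table_equiv_of_words mul (0, 0) f hf hker (by decide) (by decide)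
    (by rw [hcard]; simp [ZMod.card])
  refine ⟨e, he, ?_, ?_, ?_⟩
  · have h := hef (1, 0)
    simp only [hf_def, ZMod.val_zero, pow_zero, mul_one] at h
    rwa [show (1 : ZMod 4).val = 1 from rfl, pow_one] at h
  · have h := hef (0, 1)
    simp only [hf_def, ZMod.val_zero, pow_zero, one_mul] at h
    rwa [show (1 : ZMod 4).val = 1 from rfl, pow_one] at h
  · have h := hef (0, 0)
    simp only [hf_def, ZMod.val_zero, pow_zero, mul_one] at h
    exact h

end LawB

end Summit.HodgeConjecture.CorCM.GaloisTableLaws
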